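/-
Copyright (c) 2026 the pub-hodgecm-mathlib formalisation cell (harness21).  Prover seat hodgecm-mathlib-K2E1-p10 (g0), Track B ∕ K2-LIT, h413 = `stmt-HodgeConjecture-24833`,
line `K2_E1_TraceFormulaBeta`, campaign «EIS-WHITTAKER-3», WAVE 2 «W3₃ FILE B» (dealer K2E1-plan (g5) RULING 2026-09-04T09:18:48Z «(B-inert) NOW»), brick B-inert: THE INERT LOCAL
WHITTAKER FACTOR AS A PRODUCT-MEASURE INTEGRAL ON `Fin 3 → F` IN THE BASE COORDINATES `(a, b, t)` — the ψ-twisted twin of ★ (3-i) `K2E1IntertwiningLocalMeanInertU3`, computed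
with the shell formula of ★ D-W4 FILE A (no quadratic local field `E_w` appears).
-/
import Summits.HodgeConjecture.HodgeConjecture.Theorems.K2E1FiniteWhittakerSplitU3Inner      -- ★ D-W4 FILE A (this seat): `integral_radial_mul_addChar_eq`, `integral_floorWeight_mul_addChar_of_level_zero`, weights kit
import Summits.HodgeConjecture.HodgeConjecture.Theorems.K2E1IntertwiningLocalMeanInertU3     -- ★ (3-i) (K2E2-p12 g5): `integrable_inertCell_pi`, `integrable_inertCell_slice`, `integral_inertCell_pi_eq` (real, the majorant)
import Summits.HodgeConjecture.HodgeConjecture.Theorems.K2E1FiniteWhittakerInertU3          -- ★ D-W1 (K2E4-p10 g5): `integral_max_one_max_normAbs_cpow_neg` (complex floor), `one_sub_natCast_cpow_neg_ne_zero`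
import Mathlib.MeasureTheory.Integral.Pi
import HarnessLib

/-!
# K2·E1 — `K2E1WhittakerLocalMeanInertU3` («W3₃ FILE B», brick B-inert): THE INERT WHITTAKER LOCAL FACTOR ON `(Fin 3 → F, μ³)` IN BASE COORDINATES —
# `∫ max(1, max(‖a‖,‖b‖)², ‖t‖)^{−2z} · ψ₁(aξ₁) · ψ₂(bξ₂) dμ³(a,b,t) = μ(𝒪)³ · (1 − q^{−2z}) · (1 + q^{−(2z−1)})`  (`1 < Re z`, frequencies of level zero)

Track B ∕ K2-LIT, crux h413 = `stmt-HodgeConjecture-24833`, route of record `HCCMUnconditional`; cell `hodgecm-mathlib`, squad K2, ENGINE E1 (campaign «EIS-WHITTAKER-3», WAVE 2).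
THEOREMS ONLY (no `def`, no `instance`, no notation, no named-fact hypothesis, no `sorry`; default heartbeats); lane `--supports stmt-HodgeConjecture-24833 --as helper` (count-neutral).
Generic non-archimedean local field `F` (`= L⁺_v` at a place `v` INERT and unramified in `L`, `v ∉ S`), ANY additive Haar `μ`, currency `Measure.pi (fun _ : Fin 3 => μ)` on `Fin 3 → F`
(the token currency of ★ `AdelicProductIntegral` at `ι = Fin 3`, W0₃ CONVENTIONS 2fdd2f7063acaab9 §1 (W), WIRING (β) db32e2773993304c §3): base coordinates `(a, b, t)` of
`X = a + bδ_w ∈ L_w`, `‖X‖_w = max(‖a‖,‖b‖)²` (`{1,δ_w}` an integral basis, ★ (q10) FILE 2(b)), inert big-cell height `W(a,b,t) = max(1, max(‖a‖,‖b‖)², ‖t‖)` (★ (3-i) letters VERBATIM),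
exponent `2z` (the RAW section `H^z`; ★ (3-i) has `2σ`), and the character `ψ_w(ξ_w X) = ψ_w(ξ_w a)·ψ_w(ξ_w δ_w b)` SPLIT ADDITIVELY into TWO characters of `F`:
`ψ₁ := ψ_w(ξ_w ·)|_F`, `ψ₂ := ψ_w(ξ_w δ_w ·)|_F` — here ANY continuous `ψ₁, ψ₂ : AddChar F Circle` with conductor exponents `m₁, m₂` and frequencies `ξ₁, ξ₂` (★ p858310 currency
`((ψᵢ (t * ξᵢ) : Circle) : ℂ)`; at `v ∉ S_ξ` both have conductor `0` and unit frequency).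

THE MATHEMATICS [Tate1950, §2.5; Casselman1980, §3; CasselmanShalika1980, Thm. 5.4].  BY HAND, three one-variable integrals, each against at most one character:
 (t)  ★ D-W1 `integral_max_one_max_normAbs_cpow_neg`: `∫_t max(1,‖c‖,‖t‖)^{−2z} dt = max(1,‖c‖)^{1−2z}·G(2z)` with `c := a²` or `b²` (`‖c‖ = max(‖a‖,‖b‖)²`), `G(w) = ∫ max(1,‖t‖)^{−w}`, and
      `max(1,‖c‖)^{1−2z} = max(1,‖a‖,‖b‖)^{−(4z−2)}` (§1 `ofReal_sq_cpow`);
 (b)  ★ D-W4 FILE A `integral_floorWeight_mul_addChar_of_level_zero` at exponent `s = 4z − 2` (`Re s > 1 ⟸ Re z > ¾`): `∫_b max(1,‖a‖,‖b‖)^{−s} ψ₂(bξ₂) db = μ(𝒪)(max(1,‖a‖)^{−s} − max(q,‖a‖)^{−s})`;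
 (a)  ★ THE SHELL FORMULA `integral_radial_mul_addChar_eq` (level zero): the radial weight `max(1,‖a‖)^{−s} − max(q,‖a‖)^{−s}` is `1 − q^{−s}` on `𝒪` and `0` on the sphere `‖a‖ = q`, so
      `∫_a (…) ψ₁(aξ₁) da = μ(𝒪)(1 − q^{−s})`;
hence `∫ = G(2z)·μ(𝒪)²·(1 − q^{−(4z−2)}) = μ(𝒪)³·(1−q^{−2z})(1−q^{−(2z−1)})⁻¹·(1−q^{−(2z−1)})(1+q^{−(2z−1)}) = μ(𝒪)³(1 − q^{−2z})(1 + q^{−(2z−1)})` — the `ε_v = −1` unit value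
`ζ_{L,w}(z)⁻¹·L_v(2z−1, ε)⁻¹·μ(𝒪)³` of the Whittaker normaliser (W0₃ §4 (ii)), in agreement with ★ D-W1∕C1₃ over `(L_w, L⁺_v)`.
* §1 helpers (`ofReal_sq_cpow`; the square `c` with `‖c‖ = max(‖a‖,‖b‖)²` is ★ `exists_normAbs_eq_max_sq`; the complex weight and its norm); §2 `Integrable` on `μ³` and on slices for `1 < Re z` (★ (3-i) real majorants);
  §3 FUBINI `∫ dμ³ = ∫_a ∫_b ∫_t` (★ (3-i)'s route: `piFinSuccAbove 0`, `finTwoArrow`, `integral_prod` ×2); §4 the three one-variable integrals and **`integral_whittakerInertCell_pi_eq`** (unit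
  value); §5 every frequency: the trivial bound `‖∫‖ ≤` ★ (3-i) value at `σ = Re z`.
SAT-WITNESS: nothing is quantified over a structure.
HONEST LABEL: HC_CM is proved only modulo the 7 printed citations (2 remaining named inputs: hLiu418 = `stmt-HodgeConjecture-24832`, h413 = `stmt-HodgeConjecture-24833`)
until rung 0 closes; this file asserts no named fact and closes no socket; count-neutral.
References: [Tate1950] §2.5 · [Casselman1980] §3, Thm. 3.1 · [CasselmanShalika1980] Thm. 5.4 · [TateThesis1967] Ch. XV §3.3.
-/

set_option autoImplicit false
-- the mandated namespace repeats the single-problem summit's segment (`HodgeConjecture.HodgeConjecture`)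
set_option linter.dupNamespace false

noncomputable section

open MeasureTheory MeasureTheory.Measure Filter Topology Set TopologicalSpace
open scoped NNReal ENNReal
open Literature.NumberTheory.GaloisRepresentations Literature.NumberTheory.GaloisRepresentations.IsNonarchimedeanLocalField
open Literature.NumberTheory.Automorphic Literature.NumberTheory.Automorphic.LocalFieldHaar
open Summit.HodgeConjecture.HodgeConjecture.Cruxes.HLiu418.K2LiuGKRankOneIntegral
open Summit.HodgeConjecture.HodgeConjecture.Cruxes.H413.K2E1IntertwiningLocalFactorU2 (integrable_max_one_normAbs_rpow_neg integrable_and_integral_max_one_normAbs_cpow_two_mul)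
open Summit.HodgeConjecture.HodgeConjecture.Cruxes.H413.K2E1GindikinKarpelevichSplitGL3Haar (continuous_coe_normAbs)
open Summit.HodgeConjecture.HodgeConjecture.Cruxes.H413.K2E1FiniteWhittakerSplitU3Inner
open Summit.HodgeConjecture.HodgeConjecture.Cruxes.H413.K2E1IntertwiningLocalMeanInertU3 (integrable_inertCell_pi integrable_inertCell_slice integral_inertCell_pi_eq)
open Summit.HodgeConjecture.HodgeConjecture.Cruxes.H413.K2E1FiniteWhittakerInertU3 (integral_max_one_max_normAbs_cpow_neg one_sub_natCast_cpow_neg_ne_zero)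
open Summit.HodgeConjecture.HodgeConjecture.Cruxes.H413.K2E1IntertwiningLocalFactorU3 (max_one_sq_eq exists_normAbs_eq_max_sq)

namespace Summit.HodgeConjecture.HodgeConjecture.Cruxes.H413.K2E1WhittakerLocalMeanInertU3

variable {F : Type*} [Field F] [ValuativeRel F] [TopologicalSpace F] [IsNonarchimedeanLocalField F]

/-! ## §1  Helpers: squares under complex powers, the square `c` with `‖c‖ = max(‖a‖,‖b‖)²`, the complex weight -/

omit [ValuativeRel F] [TopologicalSpace F] [IsNonarchimedeanLocalField F] in
/-- `(x²)^w = (x^w)²` for a positive real base `x` (real logarithm, no branch issue). [folklore] -/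
theorem ofReal_sq_cpow {x : ℝ} (hx : 0 < x) (w : ℂ) : (((x ^ 2 : ℝ) : ℝ) : ℂ) ^ w = (((x : ℝ) : ℂ) ^ w) ^ 2 := by
  have hx2 : (((x ^ 2 : ℝ) : ℝ) : ℂ) ≠ 0 := by exact_mod_cast (pow_pos hx 2).ne'
  have hx0 : ((x : ℝ) : ℂ) ≠ 0 := by exact_mod_cast hx.ne'
  rw [Complex.cpow_def_of_ne_zero hx2, Complex.cpow_def_of_ne_zero hx0, ← Complex.exp_nat_mul, ← Complex.ofReal_log (pow_pos hx 2).le, Real.log_pow,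
    ← Complex.ofReal_log hx.le]
  push_cast
  ring_nf

/-- `‖W^{−2z}·ψ₁·ψ₂‖ = W^{−2 Re z}` for the inert weight `W = max(1, max(‖a‖,‖b‖)², ‖t‖)`. [folklore] -/
theorem norm_inertWhittakerIntegrand (a b t : F) (z : ℂ) (c₁ c₂ : Circle) :
    ‖((max 1 (max ((max ((normAbs F a : ℝ≥0) : ℝ) ((normAbs F b : ℝ≥0) : ℝ)) ^ 2) ((normAbs F t : ℝ≥0) : ℝ)) : ℝ) : ℂ) ^ (-(2 * z)) * ((c₁ : Circle) : ℂ) * ((c₂ : Circle) : ℂ)‖ =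
      (max 1 (max ((max ((normAbs F a : ℝ≥0) : ℝ) ((normAbs F b : ℝ≥0) : ℝ)) ^ 2) ((normAbs F t : ℝ≥0) : ℝ))) ^ (-(2 * z.re)) := by
  rw [norm_mul, norm_mul, Circle.norm_coe, Circle.norm_coe, mul_one, mul_one, Complex.norm_cpow_eq_rpow_re_of_pos (lt_of_lt_of_le one_pos (le_max_left _ _)),
    Complex.neg_re, Complex.mul_re]
  norm_num

/-- The twisted inert integrand `q ↦ W(q)^{−2z}·ψ₁(q₀ξ₁)·ψ₂(q₁ξ₂)` is continuous on `Fin 3 → F`. [folklore] -/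
theorem continuous_inertWhittakerIntegrand {ψ₁ ψ₂ : AddChar F Circle} (hψ₁ : Continuous ψ₁) (hψ₂ : Continuous ψ₂) (ξ₁ ξ₂ : F) (z : ℂ) :
    Continuous fun q : Fin 3 → F => ((max 1 (max ((max ((normAbs F (q 0) : ℝ≥0) : ℝ) ((normAbs F (q 1) : ℝ≥0) : ℝ)) ^ 2) ((normAbs F (q 2) : ℝ≥0) : ℝ)) : ℝ) : ℂ) ^ (-(2 * z)) *
      ((ψ₁ (q 0 * ξ₁) : Circle) : ℂ) * ((ψ₂ (q 1 * ξ₂) : Circle) : ℂ) := by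
  have h : ∀ i : Fin 3, Continuous fun q : Fin 3 → F => ((normAbs F (q i) : ℝ≥0) : ℝ) := fun i => continuous_coe_normAbs.comp (continuous_apply i)
  exact ((continuous_ofReal_cpow_neg (continuous_const.max ((((h 0).max (h 1)).pow 2).max (h 2))) (fun _ => le_max_left _ _) (2 * z)).mul
    (continuous_subtype_val.comp (hψ₁.comp ((continuous_apply 0).mul continuous_const)))).mul
    (continuous_subtype_val.comp (hψ₂.comp ((continuous_apply 1).mul continuous_const)))

section Haar

variable [MeasurableSpace F] [BorelSpace F] (μ : Measure F) [μ.IsAddHaarMeasure]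

/-! ## §2  Integrability on `(Fin 3 → F, μ³)` and on slices (`1 < Re z`; the ★ (3-i) real majorants) -/

/-- **THE TWISTED INERT INTEGRAND IS `μ³`-INTEGRABLE** for `1 < Re z` (its modulus is the ★ (3-i) integrand at `σ = Re z`). [cite: Casselman1980, §3 Thm. 3.1] [cite: TateThesis1967, §3.3] -/
theorem integrable_whittakerInertCell_pi {ψ₁ ψ₂ : AddChar F Circle} (hψ₁ : Continuous ψ₁) (hψ₂ : Continuous ψ₂) (ξ₁ ξ₂ : F) {z : ℂ} (hz : 1 < z.re) :
    Integrable (fun q : Fin 3 → F => ((max 1 (max ((max ((normAbs F (q 0) : ℝ≥0) : ℝ) ((normAbs F (q 1) : ℝ≥0) : ℝ)) ^ 2) ((normAbs F (q 2) : ℝ≥0) : ℝ)) : ℝ) : ℂ) ^ (-(2 * z)) *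
      ((ψ₁ (q 0 * ξ₁) : Circle) : ℂ) * ((ψ₂ (q 1 * ξ₂) : Circle) : ℂ)) (Measure.pi fun _ : Fin 3 => μ) := by
  haveI := secondCountableTopology_localField F
  haveI := sigmaCompactSpace_of_isNonarchimedeanLocalField F
  exact (integrable_inertCell_pi μ hz).mono' (continuous_inertWhittakerIntegrand hψ₁ hψ₂ ξ₁ ξ₂ z).aestronglyMeasurable
    (Eventually.of_forall fun q => (norm_inertWhittakerIntegrand (q 0) (q 1) (q 2) z _ _).le)

/-- The `(b,t)`-slice of the twisted integrand is `μ⊗μ`-integrable for every `a` (`1 < Re z`; ★ (3-i) slice majorant). [cite: TateThesis1967, §3.3] -/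
theorem integrable_whittakerInertCell_slice {ψ₂ : AddChar F Circle} (hψ₂ : Continuous ψ₂) (ξ₂ : F) {z : ℂ} (hz : 1 < z.re) (a : F) (c₁ : Circle) :
    Integrable (fun p : F × F => ((max 1 (max ((max ((normAbs F a : ℝ≥0) : ℝ) ((normAbs F p.1 : ℝ≥0) : ℝ)) ^ 2) ((normAbs F p.2 : ℝ≥0) : ℝ)) : ℝ) : ℂ) ^ (-(2 * z)) *
      ((c₁ : Circle) : ℂ) * ((ψ₂ (p.1 * ξ₂) : Circle) : ℂ)) (μ.prod μ) := by
  haveI := secondCountableTopology_localField F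
  haveI := sigmaCompactSpace_of_isNonarchimedeanLocalField F
  have hcont : Continuous fun p : F × F => ((max 1 (max ((max ((normAbs F a : ℝ≥0) : ℝ) ((normAbs F p.1 : ℝ≥0) : ℝ)) ^ 2) ((normAbs F p.2 : ℝ≥0) : ℝ)) : ℝ) : ℂ) ^ (-(2 * z)) *
      ((c₁ : Circle) : ℂ) * ((ψ₂ (p.1 * ξ₂) : Circle) : ℂ) :=
    ((continuous_ofReal_cpow_neg (continuous_const.max (((continuous_const.max (continuous_coe_normAbs.comp continuous_fst)).pow 2).max
      (continuous_coe_normAbs.comp continuous_snd))) (fun _ => le_max_left _ _) (2 * z)).mul continuous_const).mul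
      (continuous_subtype_val.comp (hψ₂.comp (continuous_fst.mul continuous_const)))
  exact (integrable_inertCell_slice μ hz a).mono' hcont.aestronglyMeasurable (Eventually.of_forall fun p => (norm_inertWhittakerIntegrand a p.1 p.2 z _ _).le)

/-! ## §3  Fubini: `∫ dμ³ = ∫_a ∫_b ∫_t` -/

/-- **FUBINI FOR THE TWISTED INERT INTEGRAND** (`1 < Re z`): `∫_{Fin 3 → F} W(q)^{−2z}ψ₁(q₀ξ₁)ψ₂(q₁ξ₂) dμ³ = ∫_a ∫_b ∫_t W(a,b,t)^{−2z}ψ₁(aξ₁)ψ₂(bξ₂) dμ dμ dμ` (★ (3-i)'s route: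
separate `q₀` by `piFinSuccAbove 0`, then `finTwoArrow` and `integral_prod` twice). [cite: TateThesis1967, §3.3] -/
theorem integral_whittakerInertCell_pi_eq_iterated {ψ₁ ψ₂ : AddChar F Circle} (hψ₁ : Continuous ψ₁) (hψ₂ : Continuous ψ₂) (ξ₁ ξ₂ : F) {z : ℂ} (hz : 1 < z.re) :
    ∫ q : Fin 3 → F, ((max 1 (max ((max ((normAbs F (q 0) : ℝ≥0) : ℝ) ((normAbs F (q 1) : ℝ≥0) : ℝ)) ^ 2) ((normAbs F (q 2) : ℝ≥0) : ℝ)) : ℝ) : ℂ) ^ (-(2 * z)) *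
        ((ψ₁ (q 0 * ξ₁) : Circle) : ℂ) * ((ψ₂ (q 1 * ξ₂) : Circle) : ℂ) ∂(Measure.pi fun _ : Fin 3 => μ) =
      ∫ a, ∫ b, ∫ t, ((max 1 (max ((max ((normAbs F a : ℝ≥0) : ℝ) ((normAbs F b : ℝ≥0) : ℝ)) ^ 2) ((normAbs F t : ℝ≥0) : ℝ)) : ℝ) : ℂ) ^ (-(2 * z)) *
        ((ψ₁ (a * ξ₁) : Circle) : ℂ) * ((ψ₂ (b * ξ₂) : Circle) : ℂ) ∂μ ∂μ ∂μ := by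
  haveI := secondCountableTopology_localField F
  haveI := sigmaCompactSpace_of_isNonarchimedeanLocalField F
  set f : (Fin 3 → F) → ℂ := fun q => ((max 1 (max ((max ((normAbs F (q 0) : ℝ≥0) : ℝ) ((normAbs F (q 1) : ℝ≥0) : ℝ)) ^ 2) ((normAbs F (q 2) : ℝ≥0) : ℝ)) : ℝ) : ℂ) ^ (-(2 * z)) *
    ((ψ₁ (q 0 * ξ₁) : Circle) : ℂ) * ((ψ₂ (q 1 * ξ₂) : Circle) : ℂ) with hf
  have hfi : Integrable f (Measure.pi fun _ : Fin 3 => μ) := integrable_whittakerInertCell_pi μ hψ₁ hψ₂ ξ₁ ξ₂ hz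
  -- Step 1: separate the coordinate `0`
  set e : (Fin 3 → F) ≃ᵐ F × (Fin 2 → F) := MeasurableEquiv.piFinSuccAbove (fun _ : Fin 3 => F) 0 with he_def
  have he : MeasurePreserving e (Measure.pi fun _ : Fin 3 => μ) (μ.prod (Measure.pi fun _ : Fin 2 => μ)) :=
    measurePreserving_piFinSuccAbove (fun _ : Fin 3 => μ) 0
  have hsymm : ∀ p : F × (Fin 2 → F), f (e.symm p) =
      ((max 1 (max ((max ((normAbs F p.1 : ℝ≥0) : ℝ) ((normAbs F (p.2 0) : ℝ≥0) : ℝ)) ^ 2) ((normAbs F (p.2 1) : ℝ≥0) : ℝ)) : ℝ) : ℂ) ^ (-(2 * z)) *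
        ((ψ₁ (p.1 * ξ₁) : Circle) : ℂ) * ((ψ₂ (p.2 0 * ξ₂) : Circle) : ℂ) := by
    intro p
    have h0 : e.symm p 0 = p.1 := by
      rw [he_def, MeasurableEquiv.piFinSuccAbove_symm_apply, Fin.insertNthEquiv_apply]
      exact Fin.insertNth_apply_same _ _ _
    have h1 : e.symm p 1 = p.2 0 := by
      rw [he_def, MeasurableEquiv.piFinSuccAbove_symm_apply, Fin.insertNthEquiv_apply, show (1 : Fin 3) = Fin.succAbove 0 0 by decide]
      exact Fin.insertNth_apply_succAbove _ _ _ _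
    have h2 : e.symm p 2 = p.2 1 := by
      rw [he_def, MeasurableEquiv.piFinSuccAbove_symm_apply, Fin.insertNthEquiv_apply, show (2 : Fin 3) = Fin.succAbove 0 1 by decide]
      exact Fin.insertNth_apply_succAbove _ _ _ _
    simp only [hf, h0, h1, h2]
  have step1 : ∫ q, f q ∂(Measure.pi fun _ : Fin 3 => μ) = ∫ p, f (e.symm p) ∂(μ.prod (Measure.pi fun _ : Fin 2 => μ)) :=
    (he.symm.integral_comp' (g := f)).symm
  have hfi' : Integrable (fun p => f (e.symm p)) (μ.prod (Measure.pi fun _ : Fin 2 => μ)) :=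
    (he.symm.integrable_comp_emb e.symm.measurableEmbedding).2 hfi
  rw [step1, integral_prod _ hfi']
  refine integral_congr_ae (Eventually.of_forall fun a => ?_)
  -- Step 2: the inner integral over `Fin 2 → F` is a double integral
  have h2 : MeasurePreserving (MeasurableEquiv.finTwoArrow (α := F)) (Measure.pi fun _ : Fin 2 => μ) (μ.prod μ) := measurePreserving_finTwoArrow μ
  have hslice := integrable_whittakerInertCell_slice μ hψ₂ ξ₂ hz a (ψ₁ (a * ξ₁))
  have step2 : ∫ r : Fin 2 → F, f (e.symm (a, r)) ∂(Measure.pi fun _ : Fin 2 => μ) =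
      ∫ p : F × F, ((max 1 (max ((max ((normAbs F a : ℝ≥0) : ℝ) ((normAbs F p.1 : ℝ≥0) : ℝ)) ^ 2) ((normAbs F p.2 : ℝ≥0) : ℝ)) : ℝ) : ℂ) ^ (-(2 * z)) *
        ((ψ₁ (a * ξ₁) : Circle) : ℂ) * ((ψ₂ (p.1 * ξ₂) : Circle) : ℂ) ∂(μ.prod μ) := by
    rw [← h2.symm.integral_comp']
    refine integral_congr_ae (Eventually.of_forall fun p => ?_)
    have hp0 : (MeasurableEquiv.finTwoArrow (α := F)).symm p 0 = p.1 := rfl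
    have hp1 : (MeasurableEquiv.finTwoArrow (α := F)).symm p 1 = p.2 := rfl
    simp only [hsymm]
    rw [hp0, hp1]
  beta_reduce
  rw [step2, integral_prod _ hslice]

/-! ## §4  The three one-variable integrals; the unit value -/

/-- **(t)** the innermost integral (every `a, b`, every `w : ℂ`): `∫_t max(1, max(‖a‖,‖b‖)², ‖t‖)^{−w} dμ(t) = (max(1,‖a‖,‖b‖)^{1−w})²·… ` — precisely
`= (max(1, max(‖a‖,‖b‖))^{1−w})² · ∫ max(1,‖t‖)^{−w} dμ`, via ★ D-W1's complex floor lemma at the square `c ∈ {a², b²}` (§1). [cite: Tate1950, §2.5] [cite: Casselman1980, §3 Thm. 3.1] -/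
theorem integral_inertWeight_cpow_neg (a b : F) (w : ℂ) :
    ∫ t, ((max 1 (max ((max ((normAbs F a : ℝ≥0) : ℝ) ((normAbs F b : ℝ≥0) : ℝ)) ^ 2) ((normAbs F t : ℝ≥0) : ℝ)) : ℝ) : ℂ) ^ (-w) ∂μ =
      ((((max 1 (max ((normAbs F a : ℝ≥0) : ℝ) ((normAbs F b : ℝ≥0) : ℝ))) : ℝ) : ℂ) ^ (1 - w)) ^ 2 * ∫ t, (((max 1 ((normAbs F t : ℝ≥0) : ℝ) : ℝ) : ℂ) ^ (-w)) ∂μ := by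
  obtain ⟨c, hc⟩ := exists_normAbs_eq_max_sq a b
  have h := integral_max_one_max_normAbs_cpow_neg μ c w
  simp_rw [hc] at h
  rw [h, max_one_sq_eq (le_trans (NNReal.coe_nonneg _) (le_max_left _ _)), ofReal_sq_cpow (lt_of_lt_of_le one_pos (le_max_left _ _)) (1 - w)]

omit [MeasurableSpace F] [BorelSpace F] in
/-- `(max(1,‖a‖,‖b‖)^{1−2z})² = max(1,‖a‖,‖b‖)^{−(4z−2)}` (positive real base). [folklore] -/
theorem maxOne_cpow_one_sub_sq (a b : F) (z : ℂ) :
    ((((max 1 (max ((normAbs F a : ℝ≥0) : ℝ) ((normAbs F b : ℝ≥0) : ℝ))) : ℝ) : ℂ) ^ (1 - 2 * z)) ^ 2 =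
      (((max 1 (max ((normAbs F a : ℝ≥0) : ℝ) ((normAbs F b : ℝ≥0) : ℝ))) : ℝ) : ℂ) ^ (-(4 * z - 2)) := by
  have hM : (((max 1 (max ((normAbs F a : ℝ≥0) : ℝ) ((normAbs F b : ℝ≥0) : ℝ))) : ℝ) : ℂ) ≠ 0 := by exact_mod_cast (lt_of_lt_of_le one_pos (le_max_left _ _)).ne'
  rw [sq, ← Complex.cpow_add _ _ hM]
  ring_nf

/-- **(b)** the middle integral at a frequency of LEVEL ZERO (`ψ₂` of conductor exponent `m₂`, `ξ₂ ∈ 𝔭^{m₂} ∖ 𝔭^{m₂+1}`, `1 < Re s`):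
`∫_b max(1,‖a‖,‖b‖)^{−s} ψ₂(bξ₂) dμ(b) = μ(𝒪)·(max(1,‖a‖)^{−s} − max(q,‖a‖)^{−s})` (★ D-W4 FILE A). [cite: Casselman1980, §3] [cite: Tate1950, §2.5] -/
theorem integral_maxOne_cpow_mul_addChar_eq (a : F) {ψ₂ : AddChar F Circle} (hψ₂ : Continuous ψ₂) {m₂ : ℤ} (hm₂ : ψ₂.HasConductorExp m₂)
    {ξ₂ : F} (hξ₂ : ξ₂ ∈ primePowBall F m₂) (hξ₂' : ξ₂ ∉ primePowBall F (m₂ + 1)) {s : ℂ} (hs : 1 < s.re) :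
    ∫ b, (((max 1 (max ((normAbs F a : ℝ≥0) : ℝ) ((normAbs F b : ℝ≥0) : ℝ))) : ℝ) : ℂ) ^ (-s) * ((ψ₂ (b * ξ₂) : Circle) : ℂ) ∂μ =
      (μ.real (primePowBall F 0) : ℂ) *
        ((((max 1 ((normAbs F a : ℝ≥0) : ℝ)) : ℝ) : ℂ) ^ (-s) - (((max (residueFieldCard F : ℝ) ((normAbs F a : ℝ≥0) : ℝ)) : ℝ) : ℂ) ^ (-s)) :=
  integral_floorWeight_mul_addChar_of_level_zero μ hψ₂ hm₂ hξ₂ hξ₂' hs a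

/-- The radial weight `a ↦ max(1,‖a‖)^{−s} − max(q,‖a‖)^{−s}` is integrable for `1 < Re s` (both pieces dominated by ★ `max(1,‖a‖)^{−Re s}`). [folklore] -/
theorem integrable_maxOne_sub_maxCard_cpow {s : ℂ} (hs : 1 < s.re) :
    Integrable (fun a : F => (((max 1 ((normAbs F a : ℝ≥0) : ℝ)) : ℝ) : ℂ) ^ (-s) - (((max (residueFieldCard F : ℝ) ((normAbs F a : ℝ≥0) : ℝ)) : ℝ) : ℂ) ^ (-s)) μ := by
  have hq1 : (1 : ℝ) ≤ residueFieldCard F := one_lt_residueFieldCard_real.le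
  refine (integrable_and_integral_max_one_normAbs_cpow μ hs).1.sub ?_
  refine (integrable_max_one_normAbs_rpow_neg μ hs).mono' ?_ (Eventually.of_forall fun a => ?_)
  · exact (continuous_ofReal_cpow_neg (continuous_const.max continuous_coe_normAbs) (fun _ => hq1.trans (le_max_left _ _)) s).aestronglyMeasurable
  · rw [norm_ofReal_cpow_neg (hq1.trans (le_max_left _ _))]
    exact Real.rpow_le_rpow_of_nonpos (lt_of_lt_of_le one_pos (le_max_left _ _)) (max_le_max hq1 le_rfl) (by linarith)

/-- **(a)** the outer integral at a frequency of LEVEL ZERO (`ψ₁` of conductor exponent `m₁`, `ξ₁ ∈ 𝔭^{m₁} ∖ 𝔭^{m₁+1}`, `1 < Re s`): the radial weight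
`max(1,‖a‖)^{−s} − max(q,‖a‖)^{−s}` is `1 − q^{−s}` on `𝒪` and `0` on the sphere `‖a‖ = q`, so by ★ THE SHELL FORMULA `∫_a (…) ψ₁(aξ₁) dμ = μ(𝒪)·(1 − q^{−s})`.
[cite: Tate1950, §2.5] [cite: Casselman1980, §3] -/
theorem integral_maxOne_sub_maxCard_cpow_mul_addChar_eq {ψ₁ : AddChar F Circle} (hψ₁ : Continuous ψ₁) {m₁ : ℤ} (hm₁ : ψ₁.HasConductorExp m₁)
    {ξ₁ : F} (hξ₁ : ξ₁ ∈ primePowBall F m₁) (hξ₁' : ξ₁ ∉ primePowBall F (m₁ + 1)) {s : ℂ} (hs : 1 < s.re) :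
    ∫ a, ((((max 1 ((normAbs F a : ℝ≥0) : ℝ)) : ℝ) : ℂ) ^ (-s) - (((max (residueFieldCard F : ℝ) ((normAbs F a : ℝ≥0) : ℝ)) : ℝ) : ℂ) ^ (-s)) * ((ψ₁ (a * ξ₁) : Circle) : ℂ) ∂μ =
      (μ.real (primePowBall F 0) : ℂ) * (1 - (residueFieldCard F : ℂ) ^ (-s)) := by
  have hq1R : (1 : ℝ) < residueFieldCard F := one_lt_residueFieldCard_real
  rw [integral_radial_mul_addChar_eq μ (integrable_maxOne_sub_maxCard_cpow μ hs) (fun y y' h => by simp only [h]) hψ₁ hm₁ (n := 0)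
    (by rwa [Nat.cast_zero, add_zero]) (by rwa [Nat.cast_zero, add_zero])]
  have h0 : ∫ a in primePowBall F (-((0 : ℕ) : ℤ)), ((((max 1 ((normAbs F a : ℝ≥0) : ℝ)) : ℝ) : ℂ) ^ (-s) - (((max (residueFieldCard F : ℝ) ((normAbs F a : ℝ≥0) : ℝ)) : ℝ) : ℂ) ^ (-s)) ∂μ =
      (μ.real (primePowBall F 0) : ℂ) * (1 - (residueFieldCard F : ℂ) ^ (-s)) := by
    rw [show (-((0 : ℕ) : ℤ)) = 0 by simp, setIntegral_congr_fun (measurableSet_primePowBall 0) (fun a ha => by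
      rw [max_eq_left (coe_normAbs_le_one_of_mem ha), max_eq_left ((coe_normAbs_le_one_of_mem ha).trans hq1R.le), Complex.ofReal_one, Complex.one_cpow, Complex.ofReal_natCast]),
      setIntegral_const, Complex.real_smul]
  have h1 : ∫ a in primePowBall F (-(((0 : ℕ) : ℤ) + 1)) \ primePowBall F (-(((0 : ℕ) : ℤ) + 1) + 1),
      ((((max 1 ((normAbs F a : ℝ≥0) : ℝ)) : ℝ) : ℂ) ^ (-s) - (((max (residueFieldCard F : ℝ) ((normAbs F a : ℝ≥0) : ℝ)) : ℝ) : ℂ) ^ (-s)) ∂μ = 0 := by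
    rw [setIntegral_congr_fun (measurableSet_shell _) (fun a ha => by
      rw [coe_normAbs_of_mem_outerShell ha, zero_add, pow_one, max_eq_right hq1R.le, max_self, sub_self]), setIntegral_const, smul_zero]
  rw [h0, h1, mul_zero, sub_zero]

/-- **THE INERT LOCAL WHITTAKER FACTOR ON `(Fin 3 → F, μ³)`, UNIT VALUE** (`ψ₁, ψ₂` continuous of conductor exponents `m₁, m₂`, `ξᵢ ∈ 𝔭^{mᵢ} ∖ 𝔭^{mᵢ+1}`, `1 < Re z`):
`∫ max(1, max(‖a‖,‖b‖)², ‖t‖)^{−2z}·ψ₁(aξ₁)·ψ₂(bξ₂) dμ³(a,b,t) = μ(𝒪)³·(1 − q^{−2z})·(1 + q^{−(2z−1)})` — the `ε_v = −1` unit value of the Whittaker normaliser at an inert unramified place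
(W0₃ §4 (ii)), the ψ-twisted twin of ★ (3-i) `integral_inertCell_pi_eq`. [cite: CasselmanShalika1980, Thm. 5.4] [cite: Casselman1980, §3 Thm. 3.1] [cite: Tate1950, §2.5] -/
theorem integral_whittakerInertCell_pi_eq {ψ₁ ψ₂ : AddChar F Circle} (hψ₁ : Continuous ψ₁) (hψ₂ : Continuous ψ₂) {m₁ m₂ : ℤ}
    (hm₁ : ψ₁.HasConductorExp m₁) (hm₂ : ψ₂.HasConductorExp m₂) {ξ₁ ξ₂ : F}
    (hξ₁ : ξ₁ ∈ primePowBall F m₁) (hξ₁' : ξ₁ ∉ primePowBall F (m₁ + 1)) (hξ₂ : ξ₂ ∈ primePowBall F m₂) (hξ₂' : ξ₂ ∉ primePowBall F (m₂ + 1))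
    {z : ℂ} (hz : 1 < z.re) :
    ∫ q : Fin 3 → F, ((max 1 (max ((max ((normAbs F (q 0) : ℝ≥0) : ℝ) ((normAbs F (q 1) : ℝ≥0) : ℝ)) ^ 2) ((normAbs F (q 2) : ℝ≥0) : ℝ)) : ℝ) : ℂ) ^ (-(2 * z)) *
        ((ψ₁ (q 0 * ξ₁) : Circle) : ℂ) * ((ψ₂ (q 1 * ξ₂) : Circle) : ℂ) ∂(Measure.pi fun _ : Fin 3 => μ) =
      (μ.real (primePowBall F 0) : ℂ) ^ 3 * ((1 - (residueFieldCard F : ℂ) ^ (-(2 * z))) * (1 + (residueFieldCard F : ℂ) ^ (-(2 * z - 1)))) := by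
  have hs : 1 < (4 * z - 2 : ℂ).re := by
    simp only [Complex.sub_re, Complex.mul_re, Complex.re_ofNat, Complex.im_ofNat, zero_mul, sub_zero]
    linarith
  have hz2 : 1 / 2 < z.re := by linarith
  rw [integral_whittakerInertCell_pi_eq_iterated μ hψ₁ hψ₂ ξ₁ ξ₂ hz]
  -- (t): the innermost integral
  have ht : ∀ a b : F, ∫ t, ((max 1 (max ((max ((normAbs F a : ℝ≥0) : ℝ) ((normAbs F b : ℝ≥0) : ℝ)) ^ 2) ((normAbs F t : ℝ≥0) : ℝ)) : ℝ) : ℂ) ^ (-(2 * z)) *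
        ((ψ₁ (a * ξ₁) : Circle) : ℂ) * ((ψ₂ (b * ξ₂) : Circle) : ℂ) ∂μ =
      (∫ t, (((max 1 ((normAbs F t : ℝ≥0) : ℝ) : ℝ) : ℂ) ^ (-(2 * z))) ∂μ) * ((ψ₁ (a * ξ₁) : Circle) : ℂ) *
        ((((max 1 (max ((normAbs F a : ℝ≥0) : ℝ) ((normAbs F b : ℝ≥0) : ℝ))) : ℝ) : ℂ) ^ (-(4 * z - 2)) * ((ψ₂ (b * ξ₂) : Circle) : ℂ)) := by
    intro a b
    rw [integral_mul_const, integral_mul_const, integral_inertWeight_cpow_neg μ a b (2 * z), maxOne_cpow_one_sub_sq]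
    ring
  simp_rw [ht]
  simp_rw [integral_const_mul]
  -- (b): the middle integral
  simp_rw [integral_maxOne_cpow_mul_addChar_eq μ _ hψ₂ hm₂ hξ₂ hξ₂' hs]
  -- (a): the outer integral
  have hre : ∀ a : F, (∫ t, (((max 1 ((normAbs F t : ℝ≥0) : ℝ) : ℝ) : ℂ) ^ (-(2 * z))) ∂μ) * ((ψ₁ (a * ξ₁) : Circle) : ℂ) *
      ((μ.real (primePowBall F 0) : ℂ) * ((((max 1 ((normAbs F a : ℝ≥0) : ℝ)) : ℝ) : ℂ) ^ (-(4 * z - 2)) - (((max (residueFieldCard F : ℝ) ((normAbs F a : ℝ≥0) : ℝ)) : ℝ) : ℂ) ^ (-(4 * z - 2)))) =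
      ((∫ t, (((max 1 ((normAbs F t : ℝ≥0) : ℝ) : ℝ) : ℂ) ^ (-(2 * z))) ∂μ) * (μ.real (primePowBall F 0) : ℂ)) *
        (((((max 1 ((normAbs F a : ℝ≥0) : ℝ)) : ℝ) : ℂ) ^ (-(4 * z - 2)) - (((max (residueFieldCard F : ℝ) ((normAbs F a : ℝ≥0) : ℝ)) : ℝ) : ℂ) ^ (-(4 * z - 2))) *
          ((ψ₁ (a * ξ₁) : Circle) : ℂ)) := fun a => by ring
  simp_rw [hre]
  rw [integral_const_mul, integral_maxOne_sub_maxCard_cpow_mul_addChar_eq μ hψ₁ hm₁ hξ₁ hξ₁' hs, (integrable_and_integral_max_one_normAbs_cpow_two_mul μ hz2).2]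
  -- the algebra `G(2z)·(1 − q^{−(4z−2)}) = (1 − q^{−2z})(1 + q^{−(2z−1)})`
  have hq : (residueFieldCard F : ℂ) ≠ 0 := Nat.cast_ne_zero.2 (residueFieldCard_ne_zero F)
  have hne : (1 : ℂ) - (residueFieldCard F : ℂ) ^ (-(2 * z - 1)) ≠ 0 :=
    one_sub_natCast_cpow_neg_ne_zero (one_lt_residueFieldCard F) (by simp only [Complex.sub_re, Complex.mul_re, Complex.re_ofNat, Complex.im_ofNat, zero_mul, sub_zero, Complex.one_re]; linarith)
  have hsq : (residueFieldCard F : ℂ) ^ (-(4 * z - 2)) = ((residueFieldCard F : ℂ) ^ (-(2 * z - 1))) ^ 2 := by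
    rw [sq, ← Complex.cpow_add _ _ hq]; ring_nf
  rw [hsq]
  field_simp
  ring

/-! ## §5  Every frequency: the trivial bound by the ★ (3-i) local mean at `σ = Re z` -/

/-- **THE TRIVIAL BOUND, UNIFORM IN THE FREQUENCIES AND THE CHARACTERS** (`1 < Re z`): `‖∫ W^{−2z}ψ₁ψ₂ dμ³‖ ≤ ∫ W^{−2Re z} dμ³ =` ★ (3-i) `integral_inertCell_pi_eq` value
`μ(𝒪)³·(1−q^{−2σ})(1+q^{−(2σ−1)})∕[(1−q^{−(2σ−2)})(1+q^{−(2σ−2)})]`, `σ = Re z` (`|ψ| = 1`). [cite: Casselman1980, §3 Thm. 3.1] [cite: TateThesis1967, §3.3] -/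
theorem norm_integral_whittakerInertCell_pi_le {ψ₁ ψ₂ : AddChar F Circle} (hψ₁ : Continuous ψ₁) (hψ₂ : Continuous ψ₂) (ξ₁ ξ₂ : F) {z : ℂ} (hz : 1 < z.re) :
    ‖∫ q : Fin 3 → F, ((max 1 (max ((max ((normAbs F (q 0) : ℝ≥0) : ℝ) ((normAbs F (q 1) : ℝ≥0) : ℝ)) ^ 2) ((normAbs F (q 2) : ℝ≥0) : ℝ)) : ℝ) : ℂ) ^ (-(2 * z)) *
        ((ψ₁ (q 0 * ξ₁) : Circle) : ℂ) * ((ψ₂ (q 1 * ξ₂) : Circle) : ℂ) ∂(Measure.pi fun _ : Fin 3 => μ)‖ ≤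
      μ.real (primePowBall F 0) ^ 3 *
        ((1 - (residueFieldCard F : ℝ) ^ (-(2 * z.re))) * (1 + (residueFieldCard F : ℝ) ^ (-(2 * z.re - 1))) /
          ((1 - (residueFieldCard F : ℝ) ^ (-(2 * z.re - 2))) * (1 + (residueFieldCard F : ℝ) ^ (-(2 * z.re - 2))))) := by
  rw [← integral_inertCell_pi_eq μ hz]
  refine (norm_integral_le_integral_norm _).trans (le_of_eq (integral_congr_ae (Eventually.of_forall fun q => ?_)))
  have h := continuous_inertWhittakerIntegrand hψ₁ hψ₂ ξ₁ ξ₂ z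
  exact norm_inertWhittakerIntegrand (q 0) (q 1) (q 2) z _ _

end Haar

end Summit.HodgeConjecture.HodgeConjecture.Cruxes.H413.K2E1WhittakerLocalMeanInertU3

end
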